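import Summits.Langlands.Langlands.Theses.SqrtFiveQuarticCovers

/-!
# Line `birth` — skeleton for the crux `ReductionToRefinedLocus` (route `SqrtFiveQuarticCovers`)

Crux (ledger stmt-Langlands-17834, FIXED, concluded below BY NAME): for `K` totally real quartic with
`√5 ∈ K` and `E / 𝓞 K` (`Δ ≠ 0`) NOT modular (Caraiani–Newton's `IsModularEllipticCurve`, written
out), the mod-`3` image is Borel or inside `C_s⁺(3)`, the mod-`5` image is Borel or inside
`H8 = ⟨diag(2,3), antidiag(1,1)⟩` or `H12 = ⟨(3 1;3 3), diag(1,4)⟩`, and the mod-`7` image is Borel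
or inside `G(e7)` (each for some framing of `E[p]`, i.e. `WeierstrassCurve.IsTorsionGaloisRep`
written out).

IDEA (the printed chain, cut at its four genuinely different inputs). The `3`- and `7`-clauses are
Box 2022 Thm 1.3 (i), (iii) (`stub_boxThreeSeven`). The `5`-clause is NOT printed for `√5 ∈ K`
(Box's Thm 1.3 (ii) needs `√5 ∉ K`); it is assembled here from
(a) `stub_fiveSpanOdd` — FLS 2015 Thm 3 at `p = 5` (valid for every totally real `K`, incl.
    `√5 ∈ K`: §1.1 of the source) + Prop. 3.1 (i) (`ρ̄(G_{K(ζ₅)}) = ρ̄(G_K) ∩ SL₂(𝔽₅)`, tree) +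
    "spanning `M₂(𝔽₅)` ⇒ absolutely irreducible" (easy half of Burnside) + oddness of `ρ̄` (complex
    conjugation, tree): some framing `ρ̄` of `E[5]` has an element of trace `0` and determinant `-1`
    in its image and the determinant-one part of its image does not span `M₂(𝔽₅)`;
(b) `stub_detSqrtFive` — the elementary lemma the grounders found missing from the tree:
    `√5 ∈ K ⇒ det ρ̄_{E,5}(Γ_K) ⊆ {±1}` (Weil pairing `det ρ̄ = χ̄₅`, and `χ̄₅(σ)` is a square, i.e.
    `±1`, when `σ` fixes `√5 = ζ + ζ⁴ − ζ² − ζ³`);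
(c) `stub_censusTrichotomy` — finite group theory inside `GL₂(𝔽₅)` (decidable; verified by
    exhaustive enumeration in this seat's folder `compute/census_trichotomy.py`: 243 subgroups of
    `{det = ±1}`, 129 meet the hypotheses, all conjugate into `B`, `H8` or `H12`; the 45 irreducible
    ones, orders 6/8/12, into `H8`/`H12` — the route's support item `GroupCensusFive` is exactly the
    irreducible case, the reducible case is "common eigenline ⇒ Borel after conjugation");
and the change of framing `ρ̄ ↦ x ρ̄ x⁻¹` (`FramedRep.conj`), PROVED inside the glue
`ReductionToRefinedLocus_of_stubs` (no stub: it is bookkeeping); the registered skeleton theorem is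
`ReductionToRefinedLocus_of : ReductionToRefinedLocus := ReductionToRefinedLocus_of_stubs stub_…`.

All four stubs are stated over existing declarations only, in the SAME unfolded rendering as the
crux (`IsModularEllipticCurve`, `IsTorsionGaloisRep` written out by their definitions; this file
imports nothing but the route file, so no named fact enters the cone). Prover pointers per stub in
its docstring. Disproof used: none exists for this crux (`ledger crux ls stmt-Langlands-17834`: no
workfiles, 2026-08-17). Dead lines: none recorded.

HARDEST STUB: `stub_fiveSpanOdd` (M/L: FLS fact + Prop 3.1 (i) + the span/absolute-irreducibility
half of Burnside + Cayley–Hamilton for the odd element). `stub_censusTrichotomy` is M (a `decide` /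
certificate over the 480-element group), `stub_detSqrtFive` is M (Galois theory of `ℚ(ζ₅) ⊃ ℚ(√5)`
inside `K̄`), `stub_boxThreeSeven` is provable now from the vendored fact `Box2022_theorem1_3`
(`Box2022_theorem1_3.quartic_of_not_isModularEllipticCurve`, file
`Literature/NumberTheory/Automorphic/TotallyRealNonModularImages.lean`, defeq to this rendering).
-/

namespace Summit.Langlands.Langlands.Cruxes.ReductionToRefinedLocus.Birth

open scoped Matrix
open Summit.Langlands.Langlands.Theses.SqrtFiveQuarticCovers
open Literature.NumberTheory.GaloisRepresentations

/-- **Stub 1 — Box 2022, Thm 1.3 (i) and (iii) over a quartic field, weak rendering.** For `K`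
totally real of degree `4` and `E / 𝓞 K` (`Δ ≠ 0`) not modular in the trace-only sense
(`IsModularEllipticCurve K E`, written out): some framing of `E[3]` is Borel (entries `(1,0)` zero)
or lands in `C_s⁺(3) = ⟨diag(1,2), antidiag(1,1)⟩`, and some framing of `E[7]` is Borel or lands in
`G(e7) = ⟨(0 5;3 0), (5 0;3 2)⟩` (`K ∩ ℚ(ζ₇) = ℚ` is automatic for `[K:ℚ] = 4`). Why plausible: it
is a printed theorem (Breuil–Diamond/FLS Thm 3 + Rubin at `3`; FLS Thm 4 + Prop 9.1 (c) +
Kalyanswamy 2018 at `7`). Size: provable now from the named fact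
`Literature.NumberTheory.Automorphic.Box2022_theorem1_3` via
`Box2022_theorem1_3.quartic_of_not_isModularEllipticCurve` (TotallyRealNonModularImages.lean;
this statement is that theorem with `IsModularEllipticCurve` / `IsTorsionGaloisRep` unfolded,
`Iff.rfl`). Sources: Box2022 Thm 1.3; FreitasLeHungSiksek2015 Thms 3–4, Prop 9.1; Kalyanswamy2018
Thm 1.2. -/
theorem stub_boxThreeSeven :
    ∀ (K : Type) [Field K] [NumberField K], NumberField.IsTotallyReal K → Module.finrank ℚ K = 4 → ∀ E : WeierstrassCurve (NumberField.RingOfIntegers K), E.Δ ≠ 0 → ¬ ((E.baseChange K).HasCM ∨ ∃ (hF : Literature.NumberTheory.Automorphic.isCompact_glFiniteIntegralLevel 2 K) (π : Literature.NumberTheory.Automorphic.CuspidalAutomorphicRepData 2 K hF), π.1.HasWeightZero ∧ ∀ᶠ w : IsDedekindDomain.HeightOneSpectrum (NumberField.RingOfIntegers K) in Filter.cofinite, ∃ α : Multiset ℂ, π.1.HasSatakeParamAt w α ∧ ((Real.sqrt w.residueCard : ℝ) : ℂ) * α.sum = (Literature.NumberTheory.Automorphic.frobTraceAt E w : ℂ))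 → (∃ ρ : Literature.NumberTheory.GaloisRepresentations.FramedGaloisRep K (ZMod 3) 2, (∃ e : (E.baseChange K).geomTorsion ((3 : ℕ) : ℤ) ≃+ (Fin 2 → ZMod 3), ∀ (σ : Field.absoluteGaloisGroup K) (P : (E.baseChange K).geomTorsion ((3 : ℕ) : ℤ)), e (σ • P) = ((ρ σ : GL (Fin 2) (ZMod 3)) : Matrix (Fin 2) (Fin 2) (ZMod 3)) *ᵥ (e P)) ∧ ((∀ σ : Field.absoluteGaloisGroup K, (((ρ σ : GL (Fin 2) (ZMod 3)) : Matrix (Fin 2) (Fin 2) (ZMod 3)) 1 0 = 0)) ∨ (∀ σ : Field.absoluteGaloisGroup K, (ρ σ : GL (Fin 2) (ZMod 3)) ∈ Subgroup.closure ({(⟨!![1, 0; 0, 2], !![1, 0; 0, 2], by decide, by decide⟩ : GL (Fin 2) (ZMod 3)), (⟨!![0, 1; 1, 0], !![0, 1; 1, 0], by decide, by decide⟩ : GL (Fin 2) (ZMod 3))} : Set (GL (Fin 2) (ZMod 3)))))) ∧ (∃ ρ : Literature.NumberTheory.GaloisRepresentations.FramedGaloisRep K (ZMod 7) 2, (∃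 e : (E.baseChange K).geomTorsion ((7 : ℕ) : ℤ) ≃+ (Fin 2 → ZMod 7), ∀ (σ : Field.absoluteGaloisGroup K) (P : (E.baseChange K).geomTorsion ((7 : ℕ) : ℤ)), e (σ • P) = ((ρ σ : GL (Fin 2) (ZMod 7)) : Matrix (Fin 2) (Fin 2) (ZMod 7)) *ᵥ (e P)) ∧ ((∀ σ : Field.absoluteGaloisGroup K, (((ρ σ : GL (Fin 2) (ZMod 7)) : Matrix (Fin 2) (Fin 2) (ZMod 7)) 1 0 = 0)) ∨ (∀ σ : Field.absoluteGaloisGroup K, (ρ σ : GL (Fin 2) (ZMod 7)) ∈ Subgroup.closure ({(⟨!![0, 5; 3, 0], !![0, 5; 3, 0], by decide, by decide⟩ : GL (Fin 2) (ZMod 7)), (⟨!![5, 0; 3, 2], !![3, 0; 6, 4], by decide, by decide⟩ : GL (Fin 2) (ZMod 7))} : Set (GL (Fin 2) (ZMod 7)))))) := by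
  sorry

/-- **Stub 2 — FLS 2015 Thm 3 at `p = 5`, in census form (the load-bearing stub).** For `K` a
totally real number field (any degree, `√5 ∈ K` allowed) and `E / 𝓞 K` (`Δ ≠ 0`) not modular in
the trace-only sense: there is a framing `ρ̄ : Γ_K →ₜ* GL₂(𝔽₅)` of the Galois action on `E[5]`
(`IsTorsionGaloisRep`, written out) such that (ii) some `ρ̄(σ)` has trace `0` and determinant `-1`
(complex conjugation: `ρ̄(c)² = 1`, `det ρ̄(c) = χ̄₅(c) = -1`, hence trace `0` by Cayley–Hamilton)
and (i') the `𝔽₅`-span of the determinant-one elements of the image `ρ̄(Γ_K)` is not all of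
`M₂(𝔽₅)`. Chain: `¬ IsModularEllipticCurve ⇒ ¬ IsAutomorphicOfWeightZero`
(`not_isAutomorphicOfWeightZero_of_not_isModularEllipticCurve`) ⇒
`¬ ModPImageAbsIrreducibleOverCyclotomic (E ⊗ K) 5` (`FLS2015_theorems3_4.not_modPImageAbsIrreducible`,
named fact `FLS2015_theorems3_4`, hypothesis of the prover's theorem) ⇒ some framing `ρ̄` and model
`L` of `K(ζ₅)` with `ρ̄|Γ_L` not absolutely irreducible ⇒ its image
`ρ̄(Γ_K) ∩ SL₂(𝔽₅)` (`range_restrictField_cyclotomic_eq_of_isTorsionGaloisRep`, with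
`det_eq_modPCyclotomicCharacter_of_isTorsionGaloisRep_holds`) cannot span `M₂(𝔽₅)` (a spanning
image stays spanning after any base change `𝔽₅ → B`, and `M₂(B)` fixes no line — the easy half
of Burnside; cf. `exists_eigenvector_of_det_eq_one_of_not_isAbsolutelyIrreducible_restrictField`);
oddness: `exists_mul_self_eq_one_and_det_eq_neg_one_of_det_eq` + `FLS2015.exists_realEmbedding`.
Why it might fail: only through a rendering mismatch (the FLS fact is vendored for
`IsAutomorphicOfWeightZero`; the bridge to the weak notion is proved). Size M/L. Sources:
FreitasLeHungSiksek2015 Thm 3, §1.1 (the `√5 ∈ K` repair), Prop 3.1 (i). -/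
theorem stub_fiveSpanOdd :
    ∀ (K : Type) [Field K] [NumberField K], NumberField.IsTotallyReal K → ∀ E : WeierstrassCurve (NumberField.RingOfIntegers K), E.Δ ≠ 0 → ¬ ((E.baseChange K).HasCM ∨ ∃ (hF : Literature.NumberTheory.Automorphic.isCompact_glFiniteIntegralLevel 2 K) (π : Literature.NumberTheory.Automorphic.CuspidalAutomorphicRepData 2 K hF), π.1.HasWeightZero ∧ ∀ᶠ w : IsDedekindDomain.HeightOneSpectrum (NumberField.RingOfIntegers K) in Filter.cofinite, ∃ α : Multiset ℂ, π.1.HasSatakeParamAt w α ∧ ((Real.sqrt w.residueCard : ℝ) : ℂ) * α.sum = (Literature.NumberTheory.Automorphic.frobTraceAt E w : ℂ)) → ∃ ρ : Literature.NumberTheory.GaloisRepresentations.FramedGaloisRep K (ZMod 5) 2, (∃ e : (E.baseChange K).geomTorsion ((5 : ℕ) : ℤ) ≃+ (Fin 2 → ZMod 5), ∀ (σ : Field.absoluteGaloisGroup K) (P : (E.baseChange K).geomTorsion ((5 : ℕ) : ℤ)), e (σ • P) = ((ρ σ : GL (Fin 2) (ZMod 5)) : Matrix (Fin 2) (Fin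 2) (ZMod 5)) *ᵥ (e P)) ∧ (∃ σ : Field.absoluteGaloisGroup K, Matrix.trace ((ρ σ : GL (Fin 2) (ZMod 5)) : Matrix (Fin 2) (Fin 2) (ZMod 5)) = 0 ∧ Matrix.det ((ρ σ : GL (Fin 2) (ZMod 5)) : Matrix (Fin 2) (Fin 2) (ZMod 5)) = -1) ∧ Submodule.span (ZMod 5) ((fun g : GL (Fin 2) (ZMod 5) => ((g : GL (Fin 2) (ZMod 5)) : Matrix (Fin 2) (Fin 2) (ZMod 5))) '' {g : GL (Fin 2) (ZMod 5) | g ∈ ρ.toMonoidHom.range ∧ Matrix.det ((g : GL (Fin 2) (ZMod 5)) : Matrix (Fin 2) (Fin 2) (ZMod 5)) = 1}) ≠ ⊤ := by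
  sorry

/-- **Stub 3 — `√5 ∈ K ⇒ det ρ̄_{E,5}(Γ_K) ⊆ {±1}`.** For a number field `K` containing a square
root of `5`, `E / 𝓞 K` with `Δ ≠ 0` and ANY framing `ρ̄` of the Galois action on `E[5]`
(`IsTorsionGaloisRep`, written out), every `det ρ̄(σ)` is `1` or `-1` in `𝔽₅`. Chain: `det ρ̄ = χ̄₅`
(Weil pairing; `WeierstrassCurve.det_eq_modPCyclotomicCharacter_of_isTorsionGaloisRep_holds`,
`E ⊗ K` is elliptic since `Δ ≠ 0`), and `χ̄₅(σ) ∈ (𝔽₅ˣ)² = {±1}` because `σ` fixes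
`√5 = ζ₅ + ζ₅⁴ − ζ₅² − ζ₅³ ∈ K` (Gauss sum), equivalently `Gal(K(ζ₅)/K) ↪ Gal(ℚ(ζ₅)/ℚ(√5))`, the
subgroup of squares (FLS 2015, Remark (iii) after Cor 2.1: "`det(G) = χ₅(Gal(ℚ(ζ₅)/ℚ(√5))) =
{1̄, 4̄}`"). The grounders flagged this as the one elementary lemma missing from the tree
(`lean search 'modPCyclotomicCharacter.*sq|IsSquare'`: 0 hits, 2026-08-16). Why it might fail: it
cannot mathematically; the Lean risk is identifying the abstract `r` with `r ^ 2 = 5` in `K` with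
the Gauss sum in `K̄` up to sign. Size M. Sources: FreitasLeHungSiksek2015 Part 4 Remark (iii);
SilvermanCSS1997 §7 (det = cyclotomic character). -/
theorem stub_detSqrtFive :
    ∀ (K : Type) [Field K] [NumberField K], (∃ r : K, r ^ 2 = 5) → ∀ E : WeierstrassCurve (NumberField.RingOfIntegers K), E.Δ ≠ 0 → ∀ ρ : Literature.NumberTheory.GaloisRepresentations.FramedGaloisRep K (ZMod 5) 2, (∃ e : (E.baseChange K).geomTorsion ((5 : ℕ) : ℤ) ≃+ (Fin 2 → ZMod 5), ∀ (σ : Field.absoluteGaloisGroup K) (P : (E.baseChange K).geomTorsion ((5 : ℕ) : ℤ)), e (σ • P) = ((ρ σ : GL (Fin 2) (ZMod 5)) : Matrix (Fin 2) (Fin 2) (ZMod 5)) *ᵥ (e P)) → ∀ σ : Field.absoluteGaloisGroup K, Matrix.det ((ρ σ : GL (Fin 2) (ZMod 5)) : Matrix (Fin 2) (Fin 2) (ZMod 5)) = 1 ∨ Matrix.det ((ρ σ : GL (Fin 2) (ZMod 5)) : Matrix (Fin 2) (Fin 2) (ZMod 5)) = -1 := by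
  sorry

/-- **Stub 4 — the `𝔽₅` census as a trichotomy (finite group theory, decidable).** Every subgroup
`G ≤ GL₂(𝔽₅)` with `det(G) ⊆ {±1}`, containing an element of trace `0` and determinant `-1`, whose
determinant-one part does not span `M₂(𝔽₅)`, is conjugate into the upper-triangular Borel
(all `(1,0)` entries zero) or into `H8 = ⟨diag(2,3), antidiag(1,1)⟩ ≅ D₄` or into
`H12 = ⟨(3 1;3 3), diag(1,4)⟩ ≅ D₆`. This is the route's support item `GroupCensusFive` (the
IRREDUCIBLE case, same hypotheses verbatim plus "no common `𝔽₅`-eigenline") together with the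
reducible case (a common eigenline `v` is moved to `e₀` by some `x`, making `x G x⁻¹` upper
triangular; cf. `FLS2015.exists_conj_apply_one_zero_eq_zero`). VERIFIED by exhaustive enumeration
(this seat, `compute/census_trichotomy.py`, 10 s): `{det = ±1}` has 243 subgroups, 129 satisfy the
three hypotheses (orders 2–40), every one is conjugate into `B`, `H8` or `H12`; the 45 irreducible
ones (orders 6, 8, 12) into `H8`/`H12`, confirming `GroupCensusFive`. In-kernel target: `decide` /
`native_decide` over `GL (Fin 2) (ZMod 5)` (finitely many subgroups), or a certificate listing a
conjugator per subgroup generated by ≤ 2 elements plus a reduction to that case. Why it might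
fail: not mathematically (checked); the risk is kernel cost of the enumeration. Size M. Sources:
FreitasLeHungSiksek2015 Part 4 Remark (iii) after Cor 2.1 (orders 6, 8, 12), Lemma 3.2 (Dickson). -/
theorem stub_censusTrichotomy :
    ∀ G : Subgroup (GL (Fin 2) (ZMod 5)), (∀ g ∈ G, Matrix.det ((g : GL (Fin 2) (ZMod 5)) : Matrix (Fin 2) (Fin 2) (ZMod 5)) = 1 ∨ Matrix.det ((g : GL (Fin 2) (ZMod 5)) : Matrix (Fin 2) (Fin 2) (ZMod 5)) = -1) → (∃ c ∈ G, Matrix.trace ((c : GL (Fin 2) (ZMod 5)) : Matrix (Fin 2) (Fin 2) (ZMod 5)) = 0 ∧ Matrix.det ((c : GL (Fin 2) (ZMod 5)) : Matrix (Fin 2) (Fin 2) (ZMod 5)) = -1) → Submodule.span (ZMod 5) ((fun g : GL (Fin 2) (ZMod 5) => ((g : GL (Fin 2) (ZMod 5)) : Matrix (Fin 2) (Fin 2) (ZMod 5))) '' {g : GL (Fin 2) (ZMod 5) | g ∈ G ∧ Matrix.det ((g : GL (Fin 2) (ZMod 5)) : Matrix (Fin 2) (Fin 2) (ZMod 5))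 = 1}) ≠ ⊤ → ∃ x : GL (Fin 2) (ZMod 5), (∀ g ∈ G, ((x * g * x⁻¹ : GL (Fin 2) (ZMod 5)) : Matrix (Fin 2) (Fin 2) (ZMod 5)) 1 0 = 0) ∨ (∀ g ∈ G, x * g * x⁻¹ ∈ Subgroup.closure ({(⟨!![2, 0; 0, 3], !![3, 0; 0, 2], by decide, by decide⟩ : GL (Fin 2) (ZMod 5)), (⟨!![0, 1; 1, 0], !![0, 1; 1, 0], by decide, by decide⟩ : GL (Fin 2) (ZMod 5))} : Set (GL (Fin 2) (ZMod 5)))) ∨ (∀ g ∈ G, x * g * x⁻¹ ∈ Subgroup.closure ({(⟨!![3, 1; 3, 3], !![3, 4; 2, 3], by decide, by decide⟩ : GL (Fin 2) (ZMod 5)), (⟨!![1, 0; 0, 4], !![1, 0; 0, 4], by decide, by decide⟩ : GL (Fin 2) (ZMod 5))} : Set (GL (Fin 2) (ZMod 5)))) := by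
  sorry

/-! ## Assembly (sorry-free glue + the registered skeleton theorem) -/

/-- **GLUE (kernel-checked, no `sorry`): the four stub STATEMENTS, taken as hypotheses, imply the
crux statement** — conclusion = the body of
`Summit.Langlands.Langlands.Theses.SqrtFiveQuarticCovers.ReductionToRefinedLocus` VERBATIM (so that
the A12 skeleton audit `#h21_check_skeleton`, whose by-name policy admits only registered obligations
as hypotheses, sees exactly one theorem concluding the crux BY NAME: `ReductionToRefinedLocus_of`
below; same convention as the sibling skeleton `Cruxes/BoxBorelFive/Lines/birth.lean`). Proof: the
`3`/`7`-clauses are `h37`; for `5`, `h5` gives a framing `ρ̄` with an odd element and non-spanning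
determinant-one part, `hdet` gives `det ⊆ {±1}` for that framing, `hcensus` applied to the image
`ρ̄(Γ_K)` gives a conjugator `x` into `B`, `H8` or `H12`, and the conjugate framing `x ρ̄ x⁻¹`
(`FramedRep.conj`, frame `e` composed with `v ↦ x v`) is again a framing of `E[5]`. -/
theorem ReductionToRefinedLocus_of_stubs
    (h37 : ∀ (K : Type) [Field K] [NumberField K], NumberField.IsTotallyReal K → Module.finrank ℚ K = 4 → ∀ E : WeierstrassCurve (NumberField.RingOfIntegers K), E.Δ ≠ 0 → ¬ ((E.baseChange K).HasCM ∨ ∃ (hF : Literature.NumberTheory.Automorphic.isCompact_glFiniteIntegralLevel 2 K) (π : Literature.NumberTheory.Automorphic.CuspidalAutomorphicRepData 2 K hF), π.1.HasWeightZero ∧ ∀ᶠ w : IsDedekindDomain.HeightOneSpectrum (NumberField.RingOfIntegers K) in Filter.cofinite, ∃ α : Multiset ℂ, π.1.HasSatakeParamAt w α ∧ ((Real.sqrt w.residueCard : ℝ) : ℂ) * α.sum = (Literature.NumberTheory.Automorphic.frobTraceAt E w : ℂ)) → (∃ ρ : Literature.NumberTheory.GaloisRepresentations.FramedGaloisRep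 K (ZMod 3) 2, (∃ e : (E.baseChange K).geomTorsion ((3 : ℕ) : ℤ) ≃+ (Fin 2 → ZMod 3), ∀ (σ : Field.absoluteGaloisGroup K) (P : (E.baseChange K).geomTorsion ((3 : ℕ) : ℤ)), e (σ • P) = ((ρ σ : GL (Fin 2) (ZMod 3)) : Matrix (Fin 2) (Fin 2) (ZMod 3)) *ᵥ (e P)) ∧ ((∀ σ : Field.absoluteGaloisGroup K, (((ρ σ : GL (Fin 2) (ZMod 3)) : Matrix (Fin 2) (Fin 2) (ZMod 3)) 1 0 = 0)) ∨ (∀ σ : Field.absoluteGaloisGroup K, (ρ σ : GL (Fin 2) (ZMod 3)) ∈ Subgroup.closure ({(⟨!![1, 0; 0, 2], !![1, 0; 0, 2], by decide, by decide⟩ : GL (Fin 2) (ZMod 3)), (⟨!![0, 1; 1, 0], !![0, 1; 1, 0], by decide, by decide⟩ : GL (Fin 2) (ZMod 3))} : Set (GL (Fin 2) (ZMod 3)))))) ∧ (∃ ρ : Literature.NumberTheory.GaloisRepresentations.FramedGaloisRep K (ZMod 7) 2, (∃ e : (E.baseChange K).geomTorsion ((7 : ℕ) : ℤ) ≃+ (Fin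 2 → ZMod 7), ∀ (σ : Field.absoluteGaloisGroup K) (P : (E.baseChange K).geomTorsion ((7 : ℕ) : ℤ)), e (σ • P) = ((ρ σ : GL (Fin 2) (ZMod 7)) : Matrix (Fin 2) (Fin 2) (ZMod 7)) *ᵥ (e P)) ∧ ((∀ σ : Field.absoluteGaloisGroup K, (((ρ σ : GL (Fin 2) (ZMod 7)) : Matrix (Fin 2) (Fin 2) (ZMod 7)) 1 0 = 0)) ∨ (∀ σ : Field.absoluteGaloisGroup K, (ρ σ : GL (Fin 2) (ZMod 7)) ∈ Subgroup.closure ({(⟨!![0, 5; 3, 0], !![0, 5; 3, 0], by decide, by decide⟩ : GL (Fin 2) (ZMod 7)), (⟨!![5, 0; 3, 2], !![3, 0; 6, 4], by decide, by decide⟩ : GL (Fin 2) (ZMod 7))} : Set (GL (Fin 2) (ZMod 7)))))))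
    (h5 : ∀ (K : Type) [Field K] [NumberField K], NumberField.IsTotallyReal K → ∀ E : WeierstrassCurve (NumberField.RingOfIntegers K), E.Δ ≠ 0 → ¬ ((E.baseChange K).HasCM ∨ ∃ (hF : Literature.NumberTheory.Automorphic.isCompact_glFiniteIntegralLevel 2 K) (π : Literature.NumberTheory.Automorphic.CuspidalAutomorphicRepData 2 K hF), π.1.HasWeightZero ∧ ∀ᶠ w : IsDedekindDomain.HeightOneSpectrum (NumberField.RingOfIntegers K) in Filter.cofinite, ∃ α : Multiset ℂ, π.1.HasSatakeParamAt w α ∧ ((Real.sqrt w.residueCard : ℝ) : ℂ) * α.sum = (Literature.NumberTheory.Automorphic.frobTraceAt E w : ℂ)) → ∃ ρ : Literature.NumberTheory.GaloisRepresentations.FramedGaloisRep K (ZMod 5) 2, (∃ e : (E.baseChange K).geomTorsion ((5 : ℕ) : ℤ) ≃+ (Fin 2 → ZMod 5), ∀ (σ : Field.absoluteGaloisGroup K) (P : (E.baseChange K).geomTorsion ((5 : ℕ) : ℤ)), e (σ • P) = ((ρ σ : GL (Fin 2) (ZMod 5)) : Matrix (Fin 2) (Fin 2) (ZMod 5)) *ᵥ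 (e P)) ∧ (∃ σ : Field.absoluteGaloisGroup K, Matrix.trace ((ρ σ : GL (Fin 2) (ZMod 5)) : Matrix (Fin 2) (Fin 2) (ZMod 5)) = 0 ∧ Matrix.det ((ρ σ : GL (Fin 2) (ZMod 5)) : Matrix (Fin 2) (Fin 2) (ZMod 5)) = -1) ∧ Submodule.span (ZMod 5) ((fun g : GL (Fin 2) (ZMod 5) => ((g : GL (Fin 2) (ZMod 5)) : Matrix (Fin 2) (Fin 2) (ZMod 5))) '' {g : GL (Fin 2) (ZMod 5) | g ∈ ρ.toMonoidHom.range ∧ Matrix.det ((g : GL (Fin 2) (ZMod 5)) : Matrix (Fin 2) (Fin 2) (ZMod 5)) = 1}) ≠ ⊤)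
    (hdet : ∀ (K : Type) [Field K] [NumberField K], (∃ r : K, r ^ 2 = 5) → ∀ E : WeierstrassCurve (NumberField.RingOfIntegers K), E.Δ ≠ 0 → ∀ ρ : Literature.NumberTheory.GaloisRepresentations.FramedGaloisRep K (ZMod 5) 2, (∃ e : (E.baseChange K).geomTorsion ((5 : ℕ) : ℤ) ≃+ (Fin 2 → ZMod 5), ∀ (σ : Field.absoluteGaloisGroup K) (P : (E.baseChange K).geomTorsion ((5 : ℕ) : ℤ)), e (σ • P) = ((ρ σ : GL (Fin 2) (ZMod 5)) : Matrix (Fin 2) (Fin 2) (ZMod 5)) *ᵥ (e P)) → ∀ σ : Field.absoluteGaloisGroup K, Matrix.det ((ρ σ : GL (Fin 2) (ZMod 5)) : Matrix (Fin 2) (Fin 2) (ZMod 5)) = 1 ∨ Matrix.det ((ρ σ : GL (Fin 2) (ZMod 5)) : Matrix (Fin 2) (Fin 2) (ZMod 5)) = -1)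
    (hcensus : ∀ G : Subgroup (GL (Fin 2) (ZMod 5)), (∀ g ∈ G, Matrix.det ((g : GL (Fin 2) (ZMod 5)) : Matrix (Fin 2) (Fin 2) (ZMod 5)) = 1 ∨ Matrix.det ((g : GL (Fin 2) (ZMod 5)) : Matrix (Fin 2) (Fin 2) (ZMod 5)) = -1) → (∃ c ∈ G, Matrix.trace ((c : GL (Fin 2) (ZMod 5)) : Matrix (Fin 2) (Fin 2) (ZMod 5)) = 0 ∧ Matrix.det ((c : GL (Fin 2) (ZMod 5)) : Matrix (Fin 2) (Fin 2) (ZMod 5)) = -1) → Submodule.span (ZMod 5) ((fun g : GL (Fin 2) (ZMod 5) => ((g : GL (Fin 2) (ZMod 5)) : Matrix (Fin 2) (Fin 2) (ZMod 5))) '' {g : GL (Fin 2) (ZMod 5) | g ∈ G ∧ Matrix.det ((g : GL (Fin 2) (ZMod 5)) : Matrix (Fin 2) (Fin 2) (ZMod 5)) = 1}) ≠ ⊤ → ∃ x : GL (Fin 2) (ZMod 5), (∀ g ∈ G, ((x * g * x⁻¹ : GL (Fin 2) (ZMod 5)) : Matrix (Fin 2) (Fin 2) (ZMod 5)) 1 0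 = 0) ∨ (∀ g ∈ G, x * g * x⁻¹ ∈ Subgroup.closure ({(⟨!![2, 0; 0, 3], !![3, 0; 0, 2], by decide, by decide⟩ : GL (Fin 2) (ZMod 5)), (⟨!![0, 1; 1, 0], !![0, 1; 1, 0], by decide, by decide⟩ : GL (Fin 2) (ZMod 5))} : Set (GL (Fin 2) (ZMod 5)))) ∨ (∀ g ∈ G, x * g * x⁻¹ ∈ Subgroup.closure ({(⟨!![3, 1; 3, 3], !![3, 4; 2, 3], by decide, by decide⟩ : GL (Fin 2) (ZMod 5)), (⟨!![1, 0; 0, 4], !![1, 0; 0, 4], by decide, by decide⟩ : GL (Fin 2) (ZMod 5))} : Set (GL (Fin 2) (ZMod 5))))) :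
    ∀ (K : Type) [Field K] [NumberField K], NumberField.IsTotallyReal K → Module.finrank ℚ K = 4 → (∃ r : K, r ^ 2 = 5) → ∀ E : WeierstrassCurve (NumberField.RingOfIntegers K), E.Δ ≠ 0 → ¬ ((E.baseChange K).HasCM ∨ ∃ (hF : Literature.NumberTheory.Automorphic.isCompact_glFiniteIntegralLevel 2 K) (π : Literature.NumberTheory.Automorphic.CuspidalAutomorphicRepData 2 K hF), π.1.HasWeightZero ∧ ∀ᶠ w : IsDedekindDomain.HeightOneSpectrum (NumberField.RingOfIntegers K) in Filter.cofinite, ∃ α : Multiset ℂ, π.1.HasSatakeParamAt w α ∧ ((Real.sqrt w.residueCard : ℝ) : ℂ) * α.sum = (Literature.NumberTheory.Automorphic.frobTraceAt E w : ℂ)) → (∃ ρ : Literature.NumberTheory.GaloisRepresentations.FramedGaloisRep K (ZMod 3) 2, (∃ e : (E.baseChange K).geomTorsion ((3 : ℕ) : ℤ) ≃+ (Fin 2 → ZMod 3), ∀ (σ : Field.absoluteGaloisGroup K) (P : (E.baseChange K).geomTorsion ((3 : ℕ) : ℤ)), e (σ • P) = ((ρ σ : GL (Fin 2) (ZMod 3))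 : Matrix (Fin 2) (Fin 2) (ZMod 3)) *ᵥ (e P)) ∧ ((∀ σ : Field.absoluteGaloisGroup K, (((ρ σ : GL (Fin 2) (ZMod 3)) : Matrix (Fin 2) (Fin 2) (ZMod 3)) 1 0 = 0)) ∨ (∀ σ : Field.absoluteGaloisGroup K, (ρ σ : GL (Fin 2) (ZMod 3)) ∈ Subgroup.closure ({(⟨!![1, 0; 0, 2], !![1, 0; 0, 2], by decide, by decide⟩ : GL (Fin 2) (ZMod 3)), (⟨!![0, 1; 1, 0], !![0, 1; 1, 0], by decide, by decide⟩ : GL (Fin 2) (ZMod 3))} : Set (GL (Fin 2) (ZMod 3)))))) ∧ ((∃ ρ : Literature.NumberTheory.GaloisRepresentations.FramedGaloisRep K (ZMod 5) 2, (∃ e : (E.baseChange K).geomTorsion ((5 : ℕ) : ℤ) ≃+ (Fin 2 → ZMod 5), ∀ (σ : Field.absoluteGaloisGroup K) (P : (E.baseChange K).geomTorsion ((5 : ℕ) : ℤ)), e (σ • P) = ((ρ σ : GL (Fin 2) (ZMod 5)) : Matrix (Fin 2) (Fin 2) (ZMod 5)) *ᵥ (e P)) ∧ (∀ σ : Field.absoluteGaloisGroup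 K, (((ρ σ : GL (Fin 2) (ZMod 5)) : Matrix (Fin 2) (Fin 2) (ZMod 5)) 1 0 = 0))) ∨ (∃ ρ : Literature.NumberTheory.GaloisRepresentations.FramedGaloisRep K (ZMod 5) 2, (∃ e : (E.baseChange K).geomTorsion ((5 : ℕ) : ℤ) ≃+ (Fin 2 → ZMod 5), ∀ (σ : Field.absoluteGaloisGroup K) (P : (E.baseChange K).geomTorsion ((5 : ℕ) : ℤ)), e (σ • P) = ((ρ σ : GL (Fin 2) (ZMod 5)) : Matrix (Fin 2) (Fin 2) (ZMod 5)) *ᵥ (e P)) ∧ ((∀ σ : Field.absoluteGaloisGroup K, (ρ σ : GL (Fin 2) (ZMod 5)) ∈ Subgroup.closure ({(⟨!![2, 0; 0, 3], !![3, 0; 0, 2], by decide, by decide⟩ : GL (Fin 2) (ZMod 5)), (⟨!![0, 1; 1, 0], !![0, 1; 1, 0], by decide, by decide⟩ : GL (Fin 2) (ZMod 5))} : Set (GL (Fin 2) (ZMod 5)))) ∨ (∀ σ : Field.absoluteGaloisGroup K, (ρ σ : GL (Fin 2) (ZMod 5)) ∈ Subgroup.closure ({(⟨!![3, 1; 3,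 3], !![3, 4; 2, 3], by decide, by decide⟩ : GL (Fin 2) (ZMod 5)), (⟨!![1, 0; 0, 4], !![1, 0; 0, 4], by decide, by decide⟩ : GL (Fin 2) (ZMod 5))} : Set (GL (Fin 2) (ZMod 5))))))) ∧ (∃ ρ : Literature.NumberTheory.GaloisRepresentations.FramedGaloisRep K (ZMod 7) 2, (∃ e : (E.baseChange K).geomTorsion ((7 : ℕ) : ℤ) ≃+ (Fin 2 → ZMod 7), ∀ (σ : Field.absoluteGaloisGroup K) (P : (E.baseChange K).geomTorsion ((7 : ℕ) : ℤ)), e (σ • P) = ((ρ σ : GL (Fin 2) (ZMod 7)) : Matrix (Fin 2) (Fin 2) (ZMod 7)) *ᵥ (e P)) ∧ ((∀ σ : Field.absoluteGaloisGroup K, (((ρ σ : GL (Fin 2) (ZMod 7)) : Matrix (Fin 2) (Fin 2) (ZMod 7)) 1 0 = 0)) ∨ (∀ σ : Field.absoluteGaloisGroup K, (ρ σ : GL (Fin 2) (ZMod 7)) ∈ Subgroup.closure ({(⟨!![0, 5; 3, 0], !![0, 5; 3, 0], by decide, by decide⟩ : GL (Fin 2) (ZMod 7)), (⟨!![5, 0;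 3, 2], !![3, 0; 6, 4], by decide, by decide⟩ : GL (Fin 2) (ZMod 7))} : Set (GL (Fin 2) (ZMod 7)))))) := by
  intro K _ _ hK hdeg h5K E hE hne
  obtain ⟨h3, h7⟩ := h37 K hK hdeg E hE hne
  obtain ⟨ρ, ⟨e, he⟩, ⟨σ₀, htr, hdet₀⟩, hspan⟩ := h5 K hK E hE hne
  have hdetρ := hdet K h5K E hE ρ ⟨e, he⟩
  obtain ⟨x, hx⟩ := hcensus ρ.toMonoidHom.range
    (by rintro _ ⟨σ, rfl⟩; exact hdetρ σ) ⟨ρ σ₀, ⟨σ₀, rfl⟩, htr, hdet₀⟩ hspan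
  -- change of framing by `x`: the frame `e` composed with `v ↦ x v`
  have hPP : ∀ v : Fin 2 → ZMod 5, ((x⁻¹ : GL (Fin 2) (ZMod 5)) : Matrix (Fin 2) (Fin 2) (ZMod 5)) *ᵥ
      ((x : Matrix (Fin 2) (Fin 2) (ZMod 5)) *ᵥ v) = v := fun v => by
    rw [Matrix.mulVec_mulVec, ← Units.val_mul, inv_mul_cancel, Units.val_one, Matrix.one_mulVec]
  have hPP' : ∀ v : Fin 2 → ZMod 5, (x : Matrix (Fin 2) (Fin 2) (ZMod 5)) *ᵥ
      (((x⁻¹ : GL (Fin 2) (ZMod 5)) : Matrix (Fin 2) (Fin 2) (ZMod 5)) *ᵥ v) = v := fun v => by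
    rw [Matrix.mulVec_mulVec, ← Units.val_mul, mul_inv_cancel, Units.val_one, Matrix.one_mulVec]
  let π : (Fin 2 → ZMod 5) ≃+ (Fin 2 → ZMod 5) :=
    { toFun := fun v => (x : Matrix (Fin 2) (Fin 2) (ZMod 5)) *ᵥ v
      invFun := fun v => ((x⁻¹ : GL (Fin 2) (ZMod 5)) : Matrix (Fin 2) (Fin 2) (ZMod 5)) *ᵥ v
      left_inv := hPP
      right_inv := hPP'
      map_add' := fun v w => Matrix.mulVec_add _ _ _ }
  have hcompat : ∃ e' : (E.baseChange K).geomTorsion ((5 : ℕ) : ℤ) ≃+ (Fin 2 → ZMod 5),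
      ∀ (σ : Field.absoluteGaloisGroup K) (P : (E.baseChange K).geomTorsion ((5 : ℕ) : ℤ)),
        e' (σ • P) = ((FramedRep.conj x ρ σ : GL (Fin 2) (ZMod 5)) : Matrix (Fin 2) (Fin 2) (ZMod 5)) *ᵥ
          (e' P) := by
    refine ⟨e.trans π, fun σ Q => ?_⟩
    change (x : Matrix (Fin 2) (Fin 2) (ZMod 5)) *ᵥ e (σ • Q) =
      ((FramedRep.conj x ρ σ : GL (Fin 2) (ZMod 5)) : Matrix (Fin 2) (Fin 2) (ZMod 5)) *ᵥ
        ((x : Matrix (Fin 2) (Fin 2) (ZMod 5)) *ᵥ e Q)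
    rw [he, FramedRep.conj_apply, Units.val_mul, Units.val_mul, ← Matrix.mulVec_mulVec,
      ← Matrix.mulVec_mulVec, hPP]
  refine ⟨h3, ?_, h7⟩
  rcases hx with hB | hH8 | hH12
  · refine Or.inl ⟨FramedRep.conj x ρ, hcompat, fun σ => ?_⟩
    rw [FramedRep.conj_apply]
    exact hB (ρ σ) ⟨σ, rfl⟩
  · refine Or.inr ⟨FramedRep.conj x ρ, hcompat, Or.inl fun σ => ?_⟩
    rw [FramedRep.conj_apply]
    exact hH8 (ρ σ) ⟨σ, rfl⟩
  · refine Or.inr ⟨FramedRep.conj x ρ, hcompat, Or.inr fun σ => ?_⟩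
    rw [FramedRep.conj_apply]
    exact hH12 (ρ σ) ⟨σ, rfl⟩

/-- **SKELETON THEOREM (registered; concludes the crux BY NAME).** `ReductionToRefinedLocus` from the
four declared stubs through the sorry-free glue `ReductionToRefinedLocus_of_stubs`; the only `sorry`s
in its closure are the four `stub_*` bodies. -/
theorem ReductionToRefinedLocus_of : ReductionToRefinedLocus :=
  ReductionToRefinedLocus_of_stubs stub_boxThreeSeven stub_fiveSpanOdd stub_detSqrtFive
    stub_censusTrichotomy

end Summit.Langlands.Langlands.Cruxes.ReductionToRefinedLocus.Birth
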